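import Summits.AtomisticToContinuum.HydrodynamicLimit.Theorems.CollisionIsometryCLTDiffuseBackwardInfluenceOneFlightShareLD
import HarnessLib

/-!
# Sketch (strategist s2, crux idea `standard-pair-growth-lemma`, lens `transfer`): first lemmas, typed

The |A| = 1 "tagged-sphere small-cap law" that a growth-lemma / standard-pair argument (ChernovDolgopyat2009) would deliver FIRST,
and the sequential product form that turns it into the promoted lever `TracerNearSetLD` (stmt-18221) ≡ `ShareLD.NearSetLD`.
Nothing is asserted: `def … : Prop` predicates + one elementary implication.
-/

namespace Summit.AtomisticToContinuum.HydrodynamicLimit.Theorems.DiffuseBackwardInfluenceShare.StandardPairSketch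

open scoped BigOperators Topology ENNReal
open Filter Set MeasureTheory
open Summit.AtomisticToContinuum.HydrodynamicLimit.Theorems.DiffuseBackwardInfluenceNeg

/-- FIRST LEMMA (|A| = 1, one slot): the TAGGED-SPHERE SMALL-CAP LAW under the invariant Gibbs law — the probability that sphere `i`
collides in slot `r` and the unit normal of its FIRST in-slot collision lies in the `α`-caps/bands of the longest columns of a
tracer-mass-`≥ δ` fraction of its blocks is `≤ K √α / δ`, uniformly in `N`, in the slot, in the admissible window and in `i`.
(The `√α` — not `α` — is forced at |A| = 1 by the length-biased first collision, lead c4 §12(b): Cauchy–Schwarz against the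
single-sphere free-time tail; a growth lemma for the one-flight offset family would give it with `K = K(σ, θ)`.) -/
def TaggedSphereSmallCap (σ θ : ℝ) : Prop :=
  ∃ K : ℝ, 0 < K ∧ ∀ δ α : ℝ, 0 < δ → 0 < α → α < 1 →
    ∀ Δ : ℕ → ℝ, (∀ N, 0 < Δ N) → Tendsto Δ atTop (𝓝 0) →
      Tendsto (fun N : ℕ => Δ N * ((N + 1 : ℕ) : ℝ) ^ ((1 : ℝ) / 3)) atTop atTop →
      ∀ S r : ℕ, 1 ≤ S → r < S →
        ∀ᶠ N : ℕ in atTop, ∀ (Φ : Flow σ N) (i : Fin (N + 1)),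
          eqLaw σ θ N Φ {y : Cfg N | δ ≤ ShareLD.nearScore σ N y (Δ N) S r α i} ≤
            ENNReal.ofReal (K * Real.sqrt α / δ)

/-- SECOND LEMMA (the growth-lemma content, sequential form): CONDITIONAL small-cap law along an enumeration of a prescribed set —
for every index set `A` and every `j ∈ A`, the probability that ALL of `A` is bad is at most `K α / δ` times the probability that
`A \ {j}` is bad ("the fresh impact offset of the LAST scoring collision is blind to the badness of the others"). Iterating over
half of `A` (the distinct scoring collisions) gives `ShareLD.NearSetLD` with base `K α / δ`. This is where N-uniform one-collision
chaos lives; standard pairs would supply it through a growth lemma for the one-flight offset families, IF its constants were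
uniform in the number of (moving) scatterers. -/
def SequentialSmallCap (σ θ : ℝ) : Prop :=
  ∃ K : ℝ, 0 < K ∧ ∀ δ α : ℝ, 0 < δ → 0 < α → α < 1 →
    ∀ Δ : ℕ → ℝ, (∀ N, 0 < Δ N) → Tendsto Δ atTop (𝓝 0) →
      Tendsto (fun N : ℕ => Δ N * ((N + 1 : ℕ) : ℝ) ^ ((1 : ℝ) / 3)) atTop atTop →
      ∀ S r : ℕ, 1 ≤ S → r < S →
        ∀ᶠ N : ℕ in atTop, ∀ (Φ : Flow σ N) (A : Finset (Fin (N + 1))) (j : Fin (N + 1)), j ∈ A →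
          eqLaw σ θ N Φ {y : Cfg N | ∀ i ∈ A, δ ≤ ShareLD.nearScore σ N y (Δ N) S r α i} ≤
            ENNReal.ofReal (Real.sqrt (K * α / δ)) *
              eqLaw σ θ N Φ {y : Cfg N | ∀ i ∈ A.erase j, δ ≤ ShareLD.nearScore σ N y (Δ N) S r α i}

/-- Elementary: the sequential form at a singleton is the |A| = 1 law with `√(Kα/δ) ≤ √K·√α/δ` for `δ ≤ 1` — recorded only to pin
the direction of the reduction; the real reduction `SequentialSmallCap → ShareLD.NearSetLD` is the product over `|A|` steps
(each step a factor `√(Kα/δ)`, i.e. base `(Kα/δ)^{|A|/2}` — exactly `NearSetLD`'s), a finite induction on `A`. [folklore] -/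
theorem sequential_singleton_shape (p q b : ℝ≥0∞) (hq : q ≤ 1) (h : p ≤ b * q) : p ≤ b :=
  h.trans (by simpa using mul_le_mul_right hq b)

end Summit.AtomisticToContinuum.HydrodynamicLimit.Theorems.DiffuseBackwardInfluenceShare.StandardPairSketch
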